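import Summits.ABC.ABC.Theses.TwistAmplification
import Summits.ABC.ABC.Theorems.TwistAmplificationMazurKaneLawSquarefulGauge

/-!
# `MazurKaneLaw` is equivalent to its germ at `s → 1⁺` (crux-strategist s2, stmt-ABC-2757)

STRUCTURAL THEOREM (no `sorry`): the crux
`MazurKaneLaw : ∀ s ∈ (1,2), ∀ ε > 0, ∃ C, ∀ N ≥ 2, #{abc triples, c ≤ N, rad(abc) ≤ c^s} ≤ C N^{s-1+ε}`
follows from its restriction to ANY right-neighbourhood `(1, 1 + η)` of `s = 1` (`mazurKaneLaw_of_germ`,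
`mazurKaneLaw_iff_germ`), and more generally from its restriction to any initial segment `(1, s₀)`
(`mazurKaneLaw_iff_initialSegment`).

MECHANISM (power-map self-similarity of Mazur's question). The SQUARING MAP
`φ(a, b, c) = (a², b·(a + c), c²)` sends abc triples to abc triples (`a² + b(a+c) = c²` because
`c = a + b`; `gcd(a², b(a+c)) = 1`), is injective, squares the height and multiplies the radical by at
most `a + c < 2c`: `rad(a²·b(a+c)·c²) = rad(abc·(a+c)) ≤ rad(abc)·(a+c)`. Hence a triple of exponent
`s` (i.e. `rad ≤ c^s`) and height `c ≤ N` maps to a triple of exponent `(1+s)/2 + o(1)` and height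
`≤ N²`, and the LAW at exponent `(1+s)/2 + ν` (bound `(N²)^{(1+s)/2+ν-1+ν} = N^{s-1+4ν}`) is EXACTLY the
law at exponent `s` (`lawAt_of_lawAt_half`). Iterating `s ↦ (1+s)/2` contracts `(1,2)` onto `1⁺`
(`germ_doubling`), so the law on `(1, 1+η)` gives the law on `(1, 1+2η)`, …, on `(1,2)`.

CONSEQUENCES recorded for the crux chain (see `STRATEGY-CENSUS.md` of this seat):
* every RANGE SPLIT of the crux is lopsided: the piece containing a right-neighbourhood of `1` is the
  whole crux (so a decomposition `High [s₀,2) ∧ Deep (1,s₀)` has `Deep ≡ crux` — costume), while the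
  difficulty is monotone towards `1⁺` (the law near `3/2` already implies the law near `2`, Kane's range);
* the deep end is where the named open problems sit: `s = 3/2` ⊇ Browning–Van Valckenborgh's conjecture
  on `x + y = z` in squareful numbers (tree: `squarefulSumCount_le_of_mazurKaneLaw`), `s → 1⁺` ⊇ "abc
  near-hits are `N^{o(1)}`" (Disproof §3 `abcHitCount_le_of_mazurKaneLaw`); by this file each of them is
  implied by the law on an arbitrarily short interval `(1, 1+η)`.

Conventions as in `Cruxes/MazurKaneLaw/Disproof.lean` §0 (`mkSet`, `LawAt s e`); this file is
self-contained (imports only the route file) so that a prover may land it verbatim under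
`Theorems/` with `--supports stmt-ABC-2757`.
-/

noncomputable section

set_option linter.dupNamespace false

namespace Summit.ABC.ABC.Cruxes.MazurKaneLaw.Germ

open Literature.NumberTheory.DiophantineGeometry UniqueFactorizationMonoid
open Summit.ABC.ABC.Theses.TwistAmplification (MazurKaneLaw)

/-! ## §0 Normal forms (verbatim the conventions of `Disproof.lean`) -/

/-- The counting set of the crux at exponent `s` and height `N`. -/
def mkSet (s : ℝ) (N : ℕ) : Set (ℕ × ℕ × ℕ) :=
  {t | IsABCTriple t.1 t.2.1 t.2.2 ∧ t.2.2 ≤ N ∧ ((rad t.1 t.2.1 t.2.2 : ℕ) : ℝ) ≤ (t.2.2 : ℝ) ^ s}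

/-- The bound of the crux at the exponent pair `(s, e)`: `∃ C, ∀ N ≥ 2, T_s(N) ≤ C · N^(s-1+e)`. -/
def LawAt (s e : ℝ) : Prop :=
  ∃ C : ℝ, ∀ N : ℕ, 2 ≤ N → ((mkSet s N).ncard : ℝ) ≤ C * (N : ℝ) ^ (s - 1 + e)

/-- The law at `s` for every `ε > 0`. -/
def LawAll (s : ℝ) : Prop := ∀ e : ℝ, 0 < e → LawAt s e

/-- The GERM of the crux on `(1, 1 + η)`. -/
def Germ (η : ℝ) : Prop := ∀ s : ℝ, 1 < s → s < 1 + η → LawAll s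

/-- The crux, definitionally. -/
theorem mazurKaneLaw_iff : MazurKaneLaw ↔ ∀ s : ℝ, 1 < s → s < 2 → LawAll s :=
  Iff.rfl

/-- The counting set is finite (it lies in `[0,N]³`). -/
theorem mkSet_finite (s : ℝ) (N : ℕ) : (mkSet s N).Finite := by
  refine ((Set.finite_Iic N).prod ((Set.finite_Iic N).prod (Set.finite_Iic N))).subset ?_
  rintro ⟨a, b, c⟩ ⟨⟨ha, hb, habc, -⟩, hcX, -⟩
  simp only [Set.mem_prod, Set.mem_Iic] at *
  omega

/-- Monotonicity of the counting set in the height. -/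
theorem mkSet_mono {s : ℝ} {M N : ℕ} (h : M ≤ N) : mkSet s M ⊆ mkSet s N := by
  rintro t ⟨ht, htM, hr⟩
  exact ⟨ht, htM.trans h, hr⟩

/-! ## §1 The squaring map -/

/-- `φ(a,b,c) = (a², b(a+c), c²)`. -/
def sq (t : ℕ × ℕ × ℕ) : ℕ × ℕ × ℕ := (t.1 ^ 2, t.2.1 * (t.1 + t.2.2), t.2.2 ^ 2)

/-- `φ` maps abc triples to abc triples. -/
theorem isABCTriple_sq {a b c : ℕ} (h : IsABCTriple a b c) :
    IsABCTriple (a ^ 2) (b * (a + c)) (c ^ 2) := by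
  obtain ⟨ha, hb, habc, hcop⟩ := h
  refine ⟨pow_pos ha 2, Nat.mul_pos hb (by omega), ?_, ?_⟩
  · subst habc; ring
  · have h1 : Nat.Coprime a (a + c) := by
      subst habc
      have : Nat.Coprime a (a + b) := Nat.coprime_self_add_right.mpr hcop
      have h2 : Nat.Coprime a (a + (a + b)) := Nat.coprime_self_add_right.mpr this
      exact h2
    exact Nat.Coprime.pow_left 2 (Nat.Coprime.mul_right hcop h1)

/-- The radical grows by at most the factor `a + c` under `φ`. -/
theorem rad_sq_le {a b c : ℕ} (h : IsABCTriple a b c) :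
    rad (a ^ 2) (b * (a + c)) (c ^ 2) ≤ rad a b c * (a + c) := by
  obtain ⟨ha, hb, habc, -⟩ := h
  have hc : 0 < c := by omega
  have hac : 0 < a + c := by omega
  have hx : a ^ 2 * (b * (a + c)) * c ^ 2 ∣ (a * b * c * (a + c)) ^ 2 :=
    ⟨b * (a + c), by ring⟩
  have hy : (a * b * c * (a + c)) ^ 2 ≠ 0 := by positivity
  have h1 : radical (a ^ 2 * (b * (a + c)) * c ^ 2) ∣ radical (a * b * c * (a + c)) := by
    have := radical_dvd_radical hx hy
    rwa [radical_pow _ (by norm_num : (2 : ℕ) ≠ 0)] at this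
  have h2 : radical (a * b * c * (a + c)) ∣ radical (a * b * c) * radical (a + c) := radical_mul_dvd
  have h3 : radical (a + c) ≤ a + c := Nat.radical_le_self_iff.mpr (by omega)
  have hpos : 0 < radical (a * b * c) * radical (a + c) :=
    Nat.mul_pos (Nat.radical_pos _) (Nat.radical_pos _)
  calc rad (a ^ 2) (b * (a + c)) (c ^ 2) = radical (a ^ 2 * (b * (a + c)) * c ^ 2) := rfl
    _ ≤ radical (a * b * c) * radical (a + c) := Nat.le_of_dvd hpos (h1.trans h2)
    _ ≤ radical (a * b * c) * (a + c) := Nat.mul_le_mul_left _ h3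
    _ = rad a b c * (a + c) := rfl

/-- `φ` is injective on triples with `a > 0`. -/
theorem sq_injOn : Set.InjOn sq {t : ℕ × ℕ × ℕ | 0 < t.1} := by
  rintro ⟨a, b, c⟩ ha ⟨a', b', c'⟩ ha' h
  simp only [sq, Prod.mk.injEq, Set.mem_setOf_eq] at h ha ha'
  obtain ⟨h1, h2, h3⟩ := h
  have hAA : a = a' := Nat.pow_left_injective (by norm_num) h1
  have hCC : c = c' := Nat.pow_left_injective (by norm_num) h3
  subst hAA hCC
  have hBB : b = b' := Nat.eq_of_mul_eq_mul_right (by omega : 0 < a + c) h2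
  subst hBB
  rfl

/-- Real-exponent bookkeeping: for `c` beyond `2^{1/(2ν)}` we have `2 ≤ c^{2ν}`. -/
theorem two_le_rpow_of_ceil_lt {ν : ℝ} (hν : 0 < ν) {c : ℕ}
    (hc : ⌈(2 : ℝ) ^ (1 / (2 * ν))⌉₊ < c) : (2 : ℝ) ≤ (c : ℝ) ^ (2 * ν) := by
  have h1 : (2 : ℝ) ^ (1 / (2 * ν)) ≤ (c : ℝ) := by
    have := Nat.le_ceil ((2 : ℝ) ^ (1 / (2 * ν)))
    have h' : (⌈(2 : ℝ) ^ (1 / (2 * ν))⌉₊ : ℝ) ≤ (c : ℝ) := by exact_mod_cast hc.le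
    linarith
  have h2 : (0 : ℝ) ≤ (2 : ℝ) ^ (1 / (2 * ν)) := Real.rpow_nonneg (by norm_num) _
  calc (2 : ℝ) = ((2 : ℝ) ^ (1 / (2 * ν))) ^ (2 * ν) := by
        rw [← Real.rpow_mul (by norm_num : (0 : ℝ) ≤ 2)]
        have : 1 / (2 * ν) * (2 * ν) = 1 := by field_simp
        rw [this, Real.rpow_one]
    _ ≤ (c : ℝ) ^ (2 * ν) := Real.rpow_le_rpow h2 h1 (by linarith)

/-- THE TRANSFER INCLUSION: `φ` maps the exponent-`s` triples of height `≤ N` with `c` large into the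
exponent-`((1+s)/2 + ν)` triples of height `≤ N²`. -/
theorem sq_mem_mkSet {s ν : ℝ} (hν : 0 < ν) {N : ℕ} {t : ℕ × ℕ × ℕ} (ht : t ∈ mkSet s N)
    (hc : ⌈(2 : ℝ) ^ (1 / (2 * ν))⌉₊ < t.2.2) : sq t ∈ mkSet ((1 + s) / 2 + ν) (N ^ 2) := by
  obtain ⟨a, b, c⟩ := t
  obtain ⟨habc, hcN, hrad⟩ := ht
  simp only at habc hcN hrad hc
  refine ⟨isABCTriple_sq habc, Nat.pow_le_pow_left hcN 2, ?_⟩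
  show ((rad (a ^ 2) (b * (a + c)) (c ^ 2) : ℕ) : ℝ) ≤ ((c ^ 2 : ℕ) : ℝ) ^ ((1 + s) / 2 + ν)
  have hrs : rad (a ^ 2) (b * (a + c)) (c ^ 2) ≤ rad a b c * (a + c) := rad_sq_le habc
  obtain ⟨ha, hb, hsum, -⟩ := habc
  have hc0 : (0 : ℝ) < c := by exact_mod_cast (show 0 < c by omega)
  have hac : ((a + c : ℕ) : ℝ) ≤ 2 * (c : ℝ) := by
    have : a + c ≤ 2 * c := by omega
    exact_mod_cast this
  have h2 : (2 : ℝ) ≤ (c : ℝ) ^ (2 * ν) := two_le_rpow_of_ceil_lt hν hc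
  have hpow : ((c ^ 2 : ℕ) : ℝ) ^ ((1 + s) / 2 + ν) = (c : ℝ) ^ s * (c : ℝ) * (c : ℝ) ^ (2 * ν) := by
    rw [Nat.cast_pow, ← Real.rpow_natCast_mul hc0.le 2]
    have : ((2 : ℕ) : ℝ) * ((1 + s) / 2 + ν) = s + 1 + 2 * ν := by push_cast; ring
    rw [this, Real.rpow_add hc0, Real.rpow_add hc0, Real.rpow_one]
  rw [hpow]
  calc ((rad (a ^ 2) (b * (a + c)) (c ^ 2) : ℕ) : ℝ) ≤ ((rad a b c * (a + c) : ℕ) : ℝ) := by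
        exact_mod_cast hrs
    _ = ((rad a b c : ℕ) : ℝ) * ((a + c : ℕ) : ℝ) := by push_cast; ring
    _ ≤ (c : ℝ) ^ s * (2 * (c : ℝ)) :=
        mul_le_mul hrad hac (by positivity) (Real.rpow_nonneg hc0.le _)
    _ = (c : ℝ) ^ s * (c : ℝ) * 2 := by ring
    _ ≤ (c : ℝ) ^ s * (c : ℝ) * (c : ℝ) ^ (2 * ν) :=
        mul_le_mul_of_nonneg_left h2 (by positivity)


/-! ## §2 One step: the law at `(1+s)/2 + 0⁺` is the law at `s` -/

/-- **TRANSFER ALONG THE SQUARING MAP.** If the law holds (for every `ε > 0`) at the exponents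
`(1+s)/2 + ν` for all small `ν > 0`, then it holds at `s` (`1 ≤ s`). Quantitatively:
`T_s(N) ≤ T_{(1+s)/2+ν}(N²) + T_s(B_ν)` with `B_ν = ⌈2^{1/(2ν)}⌉`, and
`(N²)^{(1+s)/2+ν-1+ν} = N^{s-1+4ν}`. -/
theorem lawAll_of_lawAll_half {s ν₀ : ℝ} (hs : 1 ≤ s) (hν₀ : 0 < ν₀)
    (h : ∀ ν : ℝ, 0 < ν → ν ≤ ν₀ → LawAll ((1 + s) / 2 + ν)) : LawAll s := by
  intro e he
  -- parameters
  set ν : ℝ := min (e / 4) ν₀ with hνdef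
  have hν : 0 < ν := lt_min (by linarith) hν₀
  have hνe : ν ≤ e / 4 := min_le_left _ _
  have hνν₀ : ν ≤ ν₀ := min_le_right _ _
  obtain ⟨C, hC⟩ := h ν hν hνν₀ ν hν
  set B : ℕ := ⌈(2 : ℝ) ^ (1 / (2 * ν))⌉₊ with hBdef
  set K : ℝ := ((mkSet s B).ncard : ℝ) with hKdef
  refine ⟨max C 0 + K, fun N hN => ?_⟩
  have hN1 : (1 : ℝ) ≤ N := by exact_mod_cast (show 1 ≤ N by omega)
  have hN0 : (0 : ℝ) ≤ N := by positivity
  -- split the counting set at height `B`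
  have hsplit : mkSet s N ⊆ {t ∈ mkSet s N | B < t.2.2} ∪ mkSet s B := by
    intro t ht
    by_cases hB : B < t.2.2
    · exact Or.inl ⟨ht, hB⟩
    · exact Or.inr ⟨ht.1, not_lt.mp hB, ht.2.2⟩
  have hfin : ({t ∈ mkSet s N | B < t.2.2} ∪ mkSet s B).Finite :=
    ((mkSet_finite s N).subset (Set.sep_subset _ _)).union (mkSet_finite s B)
  -- the large part injects into the squared-height set at exponent `(1+s)/2 + ν`
  have hlarge : ({t ∈ mkSet s N | B < t.2.2}).ncard ≤ (mkSet ((1 + s) / 2 + ν) (N ^ 2)).ncard := by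
    refine Set.ncard_le_ncard_of_injOn sq ?_ ?_ (mkSet_finite _ _)
    · rintro t ⟨ht, hB⟩
      exact sq_mem_mkSet hν ht hB
    · rintro t ⟨ht, -⟩ t' ⟨ht', -⟩ hEq
      exact sq_injOn ht.1.1 ht'.1.1 hEq
  have hcount : ((mkSet s N).ncard : ℝ) ≤ ((mkSet ((1 + s) / 2 + ν) (N ^ 2)).ncard : ℝ) + K := by
    have h1 : (mkSet s N).ncard ≤ ({t ∈ mkSet s N | B < t.2.2} ∪ mkSet s B).ncard :=
      Set.ncard_le_ncard hsplit hfin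
    have h2 := Set.ncard_union_le {t ∈ mkSet s N | B < t.2.2} (mkSet s B)
    have h3 : (mkSet s N).ncard ≤ (mkSet ((1 + s) / 2 + ν) (N ^ 2)).ncard + (mkSet s B).ncard := by
      omega
    rw [hKdef]
    exact_mod_cast h3
  -- the law at the squared height
  have hN2 : 2 ≤ N ^ 2 := le_trans hN (Nat.le_self_pow (by norm_num) N)
  have hlaw := hC (N ^ 2) hN2
  have hexp : (((N ^ 2 : ℕ) : ℝ)) ^ ((1 + s) / 2 + ν - 1 + ν) = (N : ℝ) ^ (s - 1 + 4 * ν) := by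
    rw [Nat.cast_pow, ← Real.rpow_natCast_mul hN0 2]
    congr 1
    push_cast
    ring
  rw [hexp] at hlaw
  -- compare exponents: `s - 1 + 4ν ≤ s - 1 + e`
  have hmono : (N : ℝ) ^ (s - 1 + 4 * ν) ≤ (N : ℝ) ^ (s - 1 + e) :=
    Real.rpow_le_rpow_of_exponent_le hN1 (by linarith)
  have hone : (1 : ℝ) ≤ (N : ℝ) ^ (s - 1 + e) := Real.one_le_rpow hN1 (by linarith)
  have hK0 : 0 ≤ K := by rw [hKdef]; positivity
  calc ((mkSet s N).ncard : ℝ) ≤ ((mkSet ((1 + s) / 2 + ν) (N ^ 2)).ncard : ℝ) + K := hcount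
    _ ≤ C * (N : ℝ) ^ (s - 1 + 4 * ν) + K := by linarith
    _ ≤ max C 0 * (N : ℝ) ^ (s - 1 + 4 * ν) + K := by
        gcongr
        exact le_max_left _ _
    _ ≤ max C 0 * (N : ℝ) ^ (s - 1 + e) + K * (N : ℝ) ^ (s - 1 + e) := by
        have hA : max C 0 * (N : ℝ) ^ (s - 1 + 4 * ν) ≤ max C 0 * (N : ℝ) ^ (s - 1 + e) :=
          mul_le_mul_of_nonneg_left hmono (le_max_right _ _)
        have hB' : K ≤ K * (N : ℝ) ^ (s - 1 + e) := by
          calc K = K * 1 := (mul_one K).symm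
            _ ≤ K * (N : ℝ) ^ (s - 1 + e) := mul_le_mul_of_nonneg_left hone hK0
        linarith
    _ = (max C 0 + K) * (N : ℝ) ^ (s - 1 + e) := by ring

/-! ## §3 Doubling the germ, and the equivalence -/

/-- The germ doubles: the law on `(1, 1+η)` gives the law on `(1, 1+2η) ∩ (1, 3]`. -/
theorem germ_doubling {η : ℝ} (hG : Germ η) : Germ (2 * η) := by
  intro s hs1 hs2
  -- `t = (1+s)/2` lies in `(1, 1+η)`; room above it: `ν₀ = (1 + η - t)/2 > 0`
  have ht1 : 1 < (1 + s) / 2 := by linarith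
  have ht2 : (1 + s) / 2 < 1 + η := by linarith
  set ν₀ : ℝ := (1 + η - (1 + s) / 2) / 2 with hν₀def
  have hν₀ : 0 < ν₀ := by rw [hν₀def]; linarith
  refine lawAll_of_lawAll_half hs1.le hν₀ ?_
  intro ν hν hνle
  exact hG ((1 + s) / 2 + ν) (by linarith) (by rw [hν₀def] at hνle; linarith)

/-- Iterated doubling: the law on `(1, 1+η)` gives the law on `(1, 1 + 2^k η)`. -/
theorem germ_iterate {η : ℝ} (hG : Germ η) (k : ℕ) : Germ (2 ^ k * η) := by
  induction k with
  | zero => simpa using hG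
  | succ k ih =>
      have := germ_doubling ih
      convert this using 1
      ring

/-- **THE CRUX FROM ITS GERM**: the Mazur–Kane law on any right-neighbourhood `(1, 1+η)` of `1`
implies it on all of `(1, 2)` (indeed on `(1, ∞)`). -/
theorem mazurKaneLaw_of_germ {η : ℝ} (hη : 0 < η) (hG : Germ η) : MazurKaneLaw := by
  rw [mazurKaneLaw_iff]
  intro s hs1 hs2
  -- choose `k` with `2^k η > 1`
  obtain ⟨k, hk⟩ := pow_unbounded_of_one_lt (1 / η) (by norm_num : (1 : ℝ) < 2)
  have hk' : 1 < 2 ^ k * η := by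
    have := (div_lt_iff₀ hη).mp hk
    linarith
  exact germ_iterate hG k s hs1 (by linarith)

/-- **EQUIVALENCE**: the crux is equivalent to its germ at `1⁺`. -/
theorem mazurKaneLaw_iff_germ : MazurKaneLaw ↔ ∃ η : ℝ, 0 < η ∧ Germ η := by
  constructor
  · intro h
    refine ⟨1, one_pos, fun s hs1 hs2 => ?_⟩
    exact (mazurKaneLaw_iff.mp h) s hs1 (by linarith)
  · rintro ⟨η, hη, hG⟩
    exact mazurKaneLaw_of_germ hη hG

/-- **EVERY INITIAL SEGMENT IS THE WHOLE CRUX**: for any `1 < s₀`, the law on `(1, s₀)` is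
equivalent to `MazurKaneLaw`; in particular the "deep range" `(1, s₀)` of a range split
`MazurKaneLaw ⟸ High [s₀,2) ∧ Deep (1,s₀)` is the crux reworded. -/
theorem mazurKaneLaw_iff_initialSegment {s₀ : ℝ} (hs₀ : 1 < s₀) (hs₀2 : s₀ ≤ 2) :
    MazurKaneLaw ↔ ∀ s : ℝ, 1 < s → s < s₀ → LawAll s := by
  constructor
  · intro h s hs1 hs2
    exact (mazurKaneLaw_iff.mp h) s hs1 (by linarith)
  · intro h
    refine mazurKaneLaw_of_germ (η := s₀ - 1) (by linarith) ?_
    intro s hs1 hs2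
    exact h s hs1 (by linarith)

/-- **WINDOWS PROPAGATE UPWARD**: the law on an exponent window `(u, v)` (`1 ≤ u`) gives the law on the
window `(2u - 1, 2v - 1)`; e.g. the law on `(3/2 - δ, 3/2 + δ)` gives it on `(2 - 2δ, 2 + 2δ)` — the range
near `2` (where Kane's theorem starts) is a CONSEQUENCE of the range near `3/2`, never the converse. -/
theorem lawAll_window_double {u v : ℝ} (hu : 1 ≤ u)
    (h : ∀ t : ℝ, u < t → t < v → LawAll t) :
    ∀ s : ℝ, 2 * u - 1 < s → s < 2 * v - 1 → LawAll s := by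
  intro s hs1 hs2
  have ht1 : u < (1 + s) / 2 := by linarith
  have ht2 : (1 + s) / 2 < v := by linarith
  set ν₀ : ℝ := (v - (1 + s) / 2) / 2 with hν₀def
  have hν₀ : 0 < ν₀ := by rw [hν₀def]; linarith
  refine lawAll_of_lawAll_half (by linarith) hν₀ ?_
  intro ν hν hνle
  exact h ((1 + s) / 2 + ν) (by linarith) (by rw [hν₀def] at hνle; linarith)

/-! ## §4 What the germ already contains (named open problems, by tree theorems) -/

/-- **THE GERM CONTAINS THE BROWNING–VAN VALCKENBORGH CONJECTURE (upper half).** The Mazur–Kane law on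
ANY interval `(1, 1 + η)` implies `N₁(B) ≪_ε B^{1/2+ε}` for primitive sums `x + y = z ≤ B` of three
squareful numbers (BVV 2012 Conj. 1; record exponent `3/5`), via `mazurKaneLaw_of_germ` and the landed
gauge `squarefulSumCount_le_of_mazurKaneLaw` (the crux at `s = 3/2`). -/
theorem squarefulSumCount_le_of_germ {η : ℝ} (hη : 0 < η) (hG : Germ η) :
    ∀ ε : ℝ, 0 < ε → ∃ C : ℝ, ∀ B : ℕ, 2 ≤ B →
      (Literature.NumberTheory.DiophantineGeometry.squarefulSumCount B : ℝ) ≤ C * (B : ℝ) ^ (1 / 2 + ε) :=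
  Summit.ABC.ABC.Theorems.MazurKaneLaw.squarefulSumCount_le_of_mazurKaneLaw (mazurKaneLaw_of_germ hη hG)

/-! ## §5 The one sub-statement that is NOT the whole crux: the high end ("Kane below 2") -/

/-- **HIGH-END LAW** — for some `s₀ < 2` the Mazur–Kane law holds on `[s₀, 2)`; i.e. Kane's theorem (range
`[2,3)`, tree `mazurKaneLaw_on_Kane_range`) extends to the left of `2`. By §3 every initial segment `(1, s₀)` is
the whole crux; this terminal segment is the only range statement not known to be equivalent to it, and it is
what the registered line `critical-kloosterman-powerful-moduli` proves by name from `stub_nearWallR2` at any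
depth `τ > 0` (`lawAt_tail_of_nearWallR2_depth`, KloostermanReach). Literal signature over tree declarations
(for a tenure planner's `workitem add`):
`∃ s₀ : ℝ, s₀ < 2 ∧ ∀ s : ℝ, s₀ ≤ s → s < 2 → ∀ ε : ℝ, 0 < ε → ∃ C : ℝ, ∀ N : ℕ, 2 ≤ N →
  (Set.ncard {t : ℕ × ℕ × ℕ | Literature.NumberTheory.DiophantineGeometry.IsABCTriple t.1 t.2.1 t.2.2 ∧ t.2.2 ≤ N ∧
    ((Literature.NumberTheory.DiophantineGeometry.rad t.1 t.2.1 t.2.2 : ℕ) : ℝ) ≤ (t.2.2 : ℝ) ^ s} : ℝ) ≤ C * (N : ℝ) ^ (s - 1 + ε)`. -/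
def MazurKaneHighEnd : Prop :=
  ∃ s₀ : ℝ, s₀ < 2 ∧ ∀ s : ℝ, s₀ ≤ s → s < 2 → LawAll s

/-- The literal form of `MazurKaneHighEnd` (definitional unfolding, for filing). -/
theorem mazurKaneHighEnd_iff :
    MazurKaneHighEnd ↔ ∃ s₀ : ℝ, s₀ < 2 ∧ ∀ s : ℝ, s₀ ≤ s → s < 2 → ∀ ε : ℝ, 0 < ε → ∃ C : ℝ, ∀ N : ℕ, 2 ≤ N →
      (Set.ncard {t : ℕ × ℕ × ℕ | IsABCTriple t.1 t.2.1 t.2.2 ∧ t.2.2 ≤ N ∧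
        ((rad t.1 t.2.1 t.2.2 : ℕ) : ℝ) ≤ (t.2.2 : ℝ) ^ s} : ℝ) ≤ C * (N : ℝ) ^ (s - 1 + ε) :=
  Iff.rfl

/-- The crux implies the high-end law (trivially, `s₀ = 3/2`). The converse is NOT claimed. -/
theorem mazurKaneHighEnd_of_mazurKaneLaw (h : MazurKaneLaw) : MazurKaneHighEnd :=
  ⟨3 / 2, by norm_num, fun s hs1 hs2 => (mazurKaneLaw_iff.mp h) s (by linarith) hs2⟩

end Summit.ABC.ABC.Cruxes.MazurKaneLaw.Germ
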